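import Summits.QuantumFields.YangMills.Theorems.BalabanUVNodesN26AtTheta13OfThm1C
import Literature.MathematicalPhysics.QuantumFieldTheory.Balaban1983to89.Node00.Record13SepLiveSelector

/-!
# DAG node N26 — N26 AT THE bg-FREE CORE DATUM OF RECORD OF NODE 00's [15]-KEYED WITNESS θ₁₅ᶜ = `Node00.theta13OfThm1C F N ε₀ ε₂₉ B₃ a₀ a₁` (plan g67 V8-CALL: the member the
# REGISTERED K0⁵ skeleton v8 keys on), WITH NO PROVISO HYPOTHESIS: def-T's `Provisos₁₃Core` is a THEOREM at θ₁₅ᶜ, so its Core datum exists as a term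

Cell `pub-ymgap`, YM-PLAN Track A (HUMAN RULING D-0062), seat `pub-ymgap-dag-n26-c` gen 9 (R134 acceleration seat, s2); helper for crux K2⁗ `EndpointGivenBR13Sep` (stmt-QuantumFields-20291;
rev-20 successor K2⁵).  COMPANION of p497784 (`…N26AtTheta13OfThm1C`, whose §2 N26 face is keyed at the v1.1 datum `datumOfRecord₁₃ θ₁₅ᶜ hP` with `hP : θ₁₅ᶜ.Provisos₁₃` DISPLAYED) and of
this seat's p510830 (`…N26AtTheta13OfThm1CC1`, the same at the C¹ witness θ₁₅ᶜᶜ¹ with the Core provisos DISCHARGED).  Plan g67 CORE-YES (2026-08-27): consumer faces key ONCE at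
`datumOfRecord₁₃Core`; every item edition's datum is the Core datum at `h.toCore` (`rfl` ∕ proof irrelevance).  K0a FILE 12a `provisos₁₃Core_theta13LiveOfNumerics_of_hasResiduals` is
HYPOTHESIS-FREE at every live member, and θ₁₅ᶜ IS the member `n := stage12NumericsOfThm1C F.L ε₀ B₃ a₀ a₁` (`theta13OfThm1C_eq`, `rfl`).

WHAT IS HERE (0 `def`, 0 `sorry`): `provisos₁₃Core_theta13OfThm1C` (the Core provisos at θ₁₅ᶜ, hypothesis-free) and ★ `n26_datumOfRecord₁₃Core_theta13OfThm1C_of_family` — N26 =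
`∃ γc > 0, BetaContH γc (datumOfRecord₁₃Core F N θ₁₅ᶜ (provisos₁₃Core_theta13OfThm1C …)).βfun` from the (D4) family road + (C-pt) on a box `0 < γ₀ ≤ θ₁₅ᶜ.γ = ½` (p497784
`betaContH_betaOfRecord₁₃_theta13OfThm1C_of_family`, its binder block verbatim), N1 DISCHARGED modulo `hsmall₁` ∕ `hA₂`, no κ hypothesis, NO proviso hypothesis — the only displayed
inputs are the (D4) family-road objects.

HONEST FRAMING.  By-name instantiation; every §-input is a DISPLAYED hypothesis of NODE O ∕ def-T (as in p497784 §2); nothing of Bałaban's analysis asserted; (D4) INSTANCE 0∕1;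
`stub_d4AtSlopeCont13` ∕ K2 NOT proved; N26 NOT discharged (VACATED ∕ (D4)-dependent; counts unmoved 5∕27 · A 5∕28); general `N`; one finite four-torus programme at fixed ε per run —
NOT the continuum limit, NOT ℝ⁴, NOT OS, NOT a mass gap, NOT Clay.  No `instance`, no `notation`, no `axiom`.
Sources (context): [I] = [Balaban1987RG1] CMP **109** (1987): (1.7) p. 261, (1.18) p. 263, (1.20)–(1.22) p. 264, (2.9) p. 266, (5.10) p. 293; [II] = [Balaban1988RG2Cluster] CMP **116**
(1988): Lemma 3 (2.38) p. 20, p. 21; [III] = [Balaban1988Convergent] CMP **119** (1988): (2.18) p. 257, (3.16) p. 268, (3.22) p. 269; [15] = [Balaban1985Variational] CMP **102** (1985):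
Thm 1 p. 279, (190) p. 308.
-/

noncomputable section

open scoped Matrix.Norms.L2Operator

namespace Summit.QuantumFields.YangMills.Theorems.BalabanUVNodesN26AtTheta13OfThm1CCoreDatum

open Literature.MathematicalPhysics.QuantumFieldTheory.Balaban1983to89
open Literature.MathematicalPhysics.QuantumFieldTheory.Balaban1983to89.FlowStep
open Literature.MathematicalPhysics.QuantumFieldTheory.Balaban1983to89.T4Continuum (T4Family)
open Literature.MathematicalPhysics.QuantumFieldTheory.Balaban1983to89.Node00
open Literature.MathematicalPhysics.QuantumFieldTheory.Balaban1983to89.B13ScaleTransfer (Pt)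
open Literature.MathematicalPhysics.QuantumFieldTheory.Balaban1983to89.B12TreeDecay (K₀ K₀_pos)
open Literature.MathematicalPhysics.QuantumFieldTheory.Balaban1983to89.Beta.RemainderChainLattice
open Literature.MathematicalPhysics.QuantumFieldTheory.Balaban1983to89.TreeLengthTorus (TDom proj)
open Literature.MathematicalPhysics.QuantumFieldTheory.Balaban1983to89.B12Decay510 (mixedDeriv)
open Literature.MathematicalPhysics.QuantumFieldTheory.Balaban1983to89.Beta.RemainderLimitTorus (LDom limKernel tproj)
open Literature.MathematicalPhysics.QuantumFieldTheory.Balaban1983to89.Beta.RemainderWOfRecordB13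
open Literature.MathematicalPhysics.QuantumFieldTheory.Balaban1983to89.Beta.RemainderDecay190
open Summit.QuantumFields.BalabanUV.Gaps
open Summit.QuantumFields.BalabanUV.Gaps.BetaContFromD4Chain
open Summit.QuantumFields.YangMills.Theorems.BalabanUVNodesN26AtRecord12KappaSufficient (C3act_c13OfRecord₁₂ kappaThreshold_le_2e4)
open Summit.QuantumFields.YangMills.Theorems.BalabanUVNodesN26AtRecord13 (betaContH_betaOfRecord₁₃_of_family)
open Summit.QuantumFields.YangMills.Theorems.BalabanUVNodesN26AtRecord13Family (condsL_faithful_theta13LiveOfNumerics_iff_of_kappa_ge)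
open Summit.QuantumFields.YangMills.Theorems.BalabanUVNodesN26AtRecord13K2Stub (d4AtSlopeOfD1Record13_at_of_family_faithful)
open Metric
open Filter Topology

variable (F : T4Family) (N : ℕ) [NeZero N]
open Summit.QuantumFields.YangMills.Theorems.BalabanUVNodesN26AtTheta13OfThm1C (betaContH_betaOfRecord₁₃_theta13OfThm1C_of_family)

/-! ## §0 def-T's bg-free Core provisos hold at θ₁₅ᶜ as a THEOREM -/

section CoreProvisos

variable (ε₀ ε₂₉ B₃ a₀ a₁ : ℝ)

/-- **def-T's bg-FREE CORE PROVISOS HOLD AT θ₁₅ᶜ AS A THEOREM** (every `ε₀ ε₂₉ B₃ a₀ a₁`, no hypothesis): K0a FILE 12a `provisos₁₃Core_theta13LiveOfNumerics_of_hasResiduals` at the member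
`n := stage12NumericsOfThm1C F.L ε₀ B₃ a₀ a₁` (`theta13OfThm1C_eq`, `rfl`) — so the CORE DATUM OF RECORD OF θ₁₅ᶜ `datumOfRecord₁₃Core F N θ₁₅ᶜ (provisos₁₃Core_theta13OfThm1C …)` EXISTS AS A
TERM (row `bg` ∕ the edition's guard fields are the ITEM's, not N26's). [cite: Balaban1988Convergent, (2.18) p.257, (3.16) p.268, (3.22) p.269; Balaban1989LargeFieldI, (0.3)–(0.4) p.176 (bookkeeping)] -/
theorem provisos₁₃Core_theta13OfThm1C : (theta13OfThm1C F N ε₀ ε₂₉ B₃ a₀ a₁).Provisos₁₃Core F N :=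
  provisos₁₃Core_theta13LiveOfNumerics_of_hasResiduals F N (stage12NumericsOfThm1C F.L ε₀ B₃ a₀ a₁) ε₂₉

end CoreProvisos

/-! ## §1 N26 at the Core datum of record of θ₁₅ᶜ from the (D4) family road + (C-pt), no proviso hypothesis -/

section RoadAtTheta15


variable {γ₀ : ℝ} {M : ℕ} [NeZero M] {μ ν : Fin 4} {α₂ : ℝ} {q : Consts190}
variable (ε₀ ε₂₉ B₃ a₀ a₁ : ℝ) (c₀ : B13.Consts)
  (lamF : ResidB13Fam₁₂ F N (theta13OfThm1C F N ε₀ ε₂₉ B₃ a₀ a₁).toStage12Params) (hγ₀ : 0 < γ₀) (hle : γ₀ ≤ (theta13OfThm1C F N ε₀ ε₂₉ B₃ a₀ a₁).γ)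
  (A1 : (k : ℕ) → (Fin (k + 1) → ℝ) → LDom 4 → Pt 4 → ℝ)
  (hm : letI := (theta13OfThm1C F N ε₀ ε₂₉ B₃ a₀ a₁).instVβ₁; letI := (theta13OfThm1C F N ε₀ ε₂₉ B₃ a₀ a₁).instVβ₂
    letI := (theta13OfThm1C F N ε₀ ε₂₉ B₃ a₀ a₁).instιβ
    ∀ k (v : Fin (k + 1) → ℝ), v ∈ Box γ₀ k →
      betaMerged F (mergedTermFamilyMatT F N (TcanOfRecord F N)
          (chiFixed29 F N (theta13OfThm1C F N ε₀ ε₂₉ B₃ a₀ a₁).ν (theta13OfThm1C F N ε₀ ε₂₉ B₃ a₀ a₁).ε₂₉)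
          (theta13OfThm1C F N ε₀ ε₂₉ B₃ a₀ a₁).εbg) (theta13OfThm1C F N ε₀ ε₂₉ B₃ a₀ a₁).ρ8
          (theta13OfThm1C F N ε₀ ε₂₉ B₃ a₀ a₁).bV k v =
        beta0OfMerged (betaMerged F (mergedTermFamilyMatT F N (TcanOfRecord F N)
            (chiFixed29 F N (theta13OfThm1C F N ε₀ ε₂₉ B₃ a₀ a₁).ν (theta13OfThm1C F N ε₀ ε₂₉ B₃ a₀ a₁).ε₂₉)
            (theta13OfThm1C F N ε₀ ε₂₉ B₃ a₀ a₁).εbg) (theta13OfThm1C F N ε₀ ε₂₉ B₃ a₀ a₁).ρ8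
            (theta13OfThm1C F N ε₀ ε₂₉ B₃ a₀ a₁).bV) (theta13OfThm1C F N ε₀ ε₂₉ B₃ a₀ a₁).v₀ k +
          B12Beta.secondMoment (fun _ _ => limKernel (A1 k v)) μ ν)
  (hcF : ∀ P k v, v ∈ Box γ₀ k →
    (lamF P k v).c = c13OfRecord₁₂ F N (theta13OfThm1C F N ε₀ ε₂₉ B₃ a₀ a₁).toStage12Params { c₀ with ε₁ := ε₂₉ })
  (hleafF : ∀ P, B13FamLeafOfRecord₁₂ F N (theta13OfThm1C F N ε₀ ε₂₉ B₃ a₀ a₁).toStage12Params { c₀ with ε₁ := ε₂₉ } lamF P)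
  (Ps : (k : ℕ) → (Fin (k + 1) → ℝ) → ℕ → B12.RunParams)
  (hn : ∀ k v, v ∈ Box γ₀ k → Tendsto (fun m => (lamF (Ps k v m) k v).n) atTop atTop)
  (hsp : ∀ k v, v ∈ Box γ₀ k → ∀ m, SpLaw (lamF (Ps k v m) k v)) (h213 : ∀ k v, v ∈ Box γ₀ k → ∀ m, Law213 (lamF (Ps k v m) k v))
  (hR : ∀ k v, v ∈ Box γ₀ k → ∀ m, (lamF (Ps k v m) k v).Restr)
  (hsmall₁ : 2 * ((F.L : ℝ) + 2) ^ 4 * c₀.A₁ * c₀.K₀ * ε₂₉ * Real.exp (5 * 20000 + 1) * K₀ 64 8 * 9 * 64 ≤ 1)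
  (hA₂ : Real.exp 1 * 9 * 64 * K₀ 64 8 ^ 2 ≤ c₀.A₂)
  (hs : SignsL (c13OfRecord₁₂ F N (theta13OfThm1C F N ε₀ ε₂₉ B₃ a₀ a₁).toStage12Params { c₀ with ε₁ := ε₂₉ }) α₂ q.B₃)
  (Wn : (k : ℕ) → (Fin (k + 1) → ℝ) → ℕ → Type) (instW : ∀ k v m, NormedAddCommGroup (Wn k v m))
  (instWs : ∀ k v m, NormedSpace ℂ (Wn k v m))
  (emb : (k : ℕ) → (v : Fin (k + 1) → ℝ) → (m : ℕ) → TDom 4 ((lamF (Ps k v m) k v).n + 1) → Wn k v m → (lamF (Ps k v m) k v).Φ)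
  (hemb : ∀ k v, v ∈ Box γ₀ k → ∀ m X, ∀ u ∈ ball (0 : Wn k v m) α₂, emb k v m X u ∈ (lamF (Ps k v m) k v).sp2 X)
  (hH : ∀ k v, v ∈ Box γ₀ k → ∀ m (X Z : TDom 4 ((lamF (Ps k v m) k v).n + 1)), Z.1 ⊆ X.1 →
    DifferentiableOn ℂ (fun u => (lamF (Ps k v m) k v).H Z (emb k v m X u)) (ball 0 α₂))
  (D : (k : ℕ) → (v : Fin (k + 1) → ℝ) → Data190 4 M (NOfLayers fun m => lamF (Ps k v m) k v) (Wn k v) q)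
  (V : (k : ℕ) → (Fin (k + 1) → ℝ) → LDom 4 → Type) (instV : ∀ k v Y, NormedAddCommGroup (V k v Y))
  (instVs : ∀ k v Y, NormedSpace ℂ (V k v Y))
  (Fw : (k : ℕ) → (v : Fin (k + 1) → ℝ) → (Y : LDom 4) → V k v Y → ℂ)
  (hFd : ∀ k v, v ∈ Box γ₀ k → ∀ Y, ∃ ρ > 0, DifferentiableOn ℂ (Fw k v Y) (ball 0 ρ))
  (r : (k : ℕ) → (v : Fin (k + 1) → ℝ) → (m : ℕ) → (Y : LDom 4) → Wn k v m →L[ℂ] V k v Y)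
  (hfac : ∀ k v, v ∈ Box γ₀ k → ∀ Y : LDom 4, ∀ᶠ m in atTop, ∀ u ∈ ball (0 : Wn k v m) α₂,
    (lamF (Ps k v m) k v).Ek1 (tproj ((lamF (Ps k v m) k v).n + 1) Y) (emb k v m (tproj ((lamF (Ps k v m) k v).n + 1) Y) u) =
      Fw k v Y (r k v m Y u))
  (t : (k : ℕ) → (v : Fin (k + 1) → ℝ) → (Y : LDom 4) → Pt 4 → V k v Y)
  (hconv : ∀ k v, v ∈ Box γ₀ k → ∀ (Y : LDom 4) (x : Pt 4),
    Tendsto (fun m => r k v m Y ((D k v).hn m (tproj ((lamF (Ps k v m) k v).n + 1) Y) (proj (((lamF (Ps k v m) k v).n + 1) * M) x)))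
      atTop (𝓝 (t k v Y x)))
  (ha : ∀ k v, v ∈ Box γ₀ k → ∀ (Y : LDom 4) (z : Pt 4), A1 k v Y z = (mixedDeriv (Fw k v Y) (t k v Y 0) (t k v Y z)).re)

include hγ₀ hle hm hcF hleafF hn hsp h213 hR hsmall₁ hA₂ hs instW instWs hemb hH hFd hfac hconv ha

/-- **★ N26 AT THE CORE DATUM OF RECORD OF θ₁₅ᶜ FROM THE FAMILY ROAD + (C-pt)** on a box `0 < γ₀ ≤ θ₁₅ᶜ.γ = ½` (`βfun_datumOfRecord₁₃Core`, `rfl`): `∃ γc > 0, BetaContH γc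
(datumOfRecord₁₃Core F N θ₁₅ᶜ (provisos₁₃Core_theta13OfThm1C …)).βfun` — the Core datum EXISTS AS A TERM (§0), so NO proviso hypothesis is displayed (p497784's v1.1 face displayed
`hP : θ₁₅ᶜ.Provisos₁₃`; an item edition's datum at θ₁₅ᶜ is this one by proof irrelevance ∕ `rfl`); N1 DISCHARGED modulo `hsmall₁` ∕ `hA₂`, no κ hypothesis; the only displayed inputs are
the (D4) family-road objects (p497784 `betaContH_betaOfRecord₁₃_theta13OfThm1C_of_family` BY NAME).  Instance 0∕1; N26 NOT discharged. [cite: Balaban1987RG1, (1.7) p.261, (1.18) p.263, (1.20)-(1.22) p.264, (2.9) p.266 and (5.10) p.293; Balaban1988RG2Cluster, Lemma 3 (2.38) p.20 and p.21; Balaban1985Variational, Thm 1 p.279, (190) p.308] -/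
theorem n26_datumOfRecord₁₃Core_theta13OfThm1C_of_family
    (hq : q.Valid (c13OfRecord₁₂ F N (theta13OfThm1C F N ε₀ ε₂₉ B₃ a₀ a₁).toStage12Params { c₀ with ε₁ := ε₂₉ }).δ₀)
    (hcpt : ∀ k (x : Pt 4), ContinuousOn (fun v : Fin (k + 1) → ℝ => limKernel (A1 k v) x) (Box γ₀ k)) :
    ∃ γc : ℝ, 0 < γc ∧
      BetaContH γc (datumOfRecord₁₃Core F N (theta13OfThm1C F N ε₀ ε₂₉ B₃ a₀ a₁) (provisos₁₃Core_theta13OfThm1C F N ε₀ ε₂₉ B₃ a₀ a₁)).βfun :=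
  ⟨γ₀, hγ₀, betaContH_betaOfRecord₁₃_theta13OfThm1C_of_family F N ε₀ ε₂₉ B₃ a₀ a₁ c₀ lamF hle A1 hm hcF hleafF Ps hn hsp h213 hR hsmall₁ hA₂
    hs Wn instW instWs emb hemb hH D V instV instVs Fw hFd r hfac t hconv ha hq hcpt⟩

end RoadAtTheta15

end Summit.QuantumFields.YangMills.Theorems.BalabanUVNodesN26AtTheta13OfThm1CCoreDatum

end
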